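import Literature.MathematicalPhysics.QuantumLattice.HardCoreBosonHalfFillingOptimal
import Literature.MathematicalPhysics.QuantumLattice.LiebMattisSectorPF
import Literature.MathematicalPhysics.QuantumLattice.GroundStateReflectionPositivity
import Literature.Probability.LatticeModels.TorusBipartite
import Mathlib.Analysis.Matrix.Order
import Mathlib.Analysis.SpecialFunctions.ContinuousFunctionalCalculus.Rpow.Basic
import Mathlib.Analysis.CStarAlgebra.ContinuousFunctionalCalculus.Commute
import HarnessLib

/-!
# The hard-core lattice Bose gas has a unique ground state, at half filling
# (Aizenman–Lieb–Seiringer–Solovej–Yngvason 2004, Appendix A — the uniqueness half)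

Trunk T-QLATTICE, family `hubbard` (cell `hubbard-cq`, transfer source «hard-core boson / XXZ»).
Companion of `HardCoreBosonHalfFillingOptimal.lean`, which proved the EXISTENCE half of
[AizenmanEtAl2004] Appendix A (a ground state of `hardCoreLatticeGas d L λ` with `S³_tot = 0`,
i.e. particle number `|Λ|/2`, for every staggered field `λ`; and `Z_β(N) ≤ Z_β(|Λ|/2)`). This file
proves the remaining, UNIQUENESS half of the printed statement

> «In this appendix we will show that `H` has a unique ground state which has particle number
> `|Λ|/2`. … The operator `H` commutes with `Σ_x S³_x`. By a Perron–Frobenius argument the ground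
> state of `H` restricted to the subspace with fixed value of `Σ_x S³_x` is unique. We claim that
> the absolute ground state of `H` corresponds to the value `Σ_x S³_x = 0`. To prove this we shall
> use reflection positivity.» ([AizenmanEtAl2004] App. A, arXiv p. 18)

following the printed proof:

* §1 (`namespace Matrix`, abstract): **the polar-decomposition argument** of App. A. For a
  reflection-symmetric real Kronecker Hamiltonian `K = A ⊗ 1 + 1 ⊗ A - Σᵢ Mᵢ ⊗ Mᵢ` and a real
  symmetric one-sided charge `X` with two-sided charge `S' = X ⊗ 1 - 1 ⊗ X`: if `ψ = vec ĉ` is a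
  ground state with `S'ψ = mψ`, the two states `vec (ĉĉ†)^{1/2}`, `vec (ĉ†ĉ)^{1/2}` are ground
  states (Kennedy–Lieb–Shastry trace inequality, `Matrix.exists_kls_tracePair`; printed
  eq. (A: `⟨ψ|H'|ψ⟩ ≥ ½⟨ψ₁|H'|ψ₁⟩ + ½⟨ψ₂|H'|ψ₂⟩`)), both annihilated by `S'`
  (`S (ĉ†ĉ)^{1/2} = (ĉ†ĉ)^{1/2} S`, printed display before (A)); if the ground state with
  `S' = 0` is unique they coincide, `ĉ†ĉ = ĉĉ†`, and `m = Tr(ĉĉ†S) - Tr(ĉ†ĉS) = 0`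
  (`Matrix.kroneckerGroundState_charge_eigenvalue_eq_zero`).
* §2 (`namespace HardCoreBoson`): **Perron–Frobenius in the magnetisation sectors** of
  `hardCoreLatticeGas d L λ` («By a Perron-Frobenius argument the ground state of `H` restricted
  to the subspace with fixed value of `Σ S³_x` is unique»): the off-diagonal matrix elements of the
  hard-core gas in the occupation basis are those of the ferromagnetic spin-½ XY model, `≤ 0`, and
  the staggered field is diagonal, so no Marshall sign is needed; ergodicity inside a sector is
  the tree's `LiebMattis.reflTransGen_of_weight_eq`; the abstract Perron–Frobenius theorem is the
  tree's `perronFrobenius_groundState_unique` (`sector_groundState_unique`).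
* §3: **assembly** — every ground state of `hardCoreLatticeGas d L λ` that is an eigenvector of
  `S³_tot` has eigenvalue `0` (`groundState_totalSpin_eigenvalue_eq_zero`, transport to the
  Kronecker picture by the sublattice flip and the plane-pair splitting of
  `HardCoreBosonHalfFillingOptimal`), hence every ground state lies in the sector `S³_tot = 0`
  (`groundSpace_le_spinZSector_zero`, weight components of eigenvectors are eigenvectors), the
  ground state is non-degenerate (`hasUniqueGroundState_hardCoreLatticeGas`), and in boson
  language the unique ground state has exactly `|Λ|/2` particles (`groundState_halfFilling`).

Scope: even torus `(ℤ/Lℤ)^d`, `d ≥ 1`, `L` even (`NeZero L`), every real staggered field `λ` —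
exactly the setting of the existence half. WHAT THIS IS NOT: no statement about the Hubbard
model; strict maximality of `Z_β(N)` at `N = |Λ|/2` is not claimed (nor in print).

## Mathlib / tree search

`lean search 'HasUniqueGroundState.*hardCore|hardCoreLatticeGas.*unique|sector_perronFrobenius'`:
PF in sectors exists for the Heisenberg antiferromagnet only (`LiebMattis.sector_perronFrobenius`,
Marshall signs); ground-state RP with a positive semidefinite ground state
(`Matrix.exists_posSemidef_groundState`) but not the two-sided polar pair; no uniqueness statement
for the hard-core gas (2026-08-28). Reused by name: `Matrix.exists_kls_tracePair`,
`Matrix.kronecker_hamiltonian_rayleigh`, `Matrix.kroneckerSum_mulVec_uncurry`,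
`Matrix.posSemidef_sub_groundEnergy`, `perronFrobenius_groundState_unique`, `sector_groundState`,
`LiebMattis.reflTransGen_of_weight_eq`, `LiebMattis.mem_spinZSector_weight_iff`,
`LiebMattis.mulVec_supported_of_commute_totalSpin_two`, `HardCoreBoson.*` of the companion file,
Mathlib's `CFC.sqrt_unique`, `Commute.cfcₙ_nnreal`.

## References

* [AizenmanEtAl2004] M. Aizenman, E. H. Lieb, R. Seiringer, J. P. Solovej, J. Yngvason,
  *Bose–Einstein quantum phase transition in an optical lattice model*, Phys. Rev. A 70 (2004)
  023612 = arXiv:cond-mat/0403240, Appendix A (arXiv pp. 18–19).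
* [LSSY2005] E. H. Lieb, R. Seiringer, J. P. Solovej, J. Yngvason, *The Mathematics of the Bose
  Gas and its Condensation* (2005), Ch. 11.
* [KLS1988JSP] T. Kennedy, E. H. Lieb, B. S. Shastry, J. Stat. Phys. 53 (1988) 1019, eqs. (20)–(25).
* [DLS1978] F. J. Dyson, E. H. Lieb, B. Simon, J. Stat. Phys. 18 (1978) 335, §4.
-/

noncomputable section

open Matrix Finset
open scoped ComplexOrder MatrixOrder Kronecker NNReal

/-! ## §1 The polar-decomposition argument (abstract Kronecker form) -/

namespace Matrix

open Literature.MathematicalPhysics.QuantumLattice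

variable {m : Type*} [Fintype m] [DecidableEq m]

/-- Homogeneous variational principle: `E₀ ‖v‖² ≤ Re ⟨v, K v⟩` for a Hermitian `K`
(Tasaki (2020) §2.1, eq. (2.1.6)). [cite: Tasaki2020, §2.1 eq. (2.1.6)] -/
theorem groundEnergy_mul_le_rayleigh [Nonempty m] {K : Matrix m m ℂ} (hK : K.IsHermitian)
    (v : m → ℂ) : K.groundEnergy * (star v ⬝ᵥ v).re ≤ (star v ⬝ᵥ K *ᵥ v).re := by
  have h := (posSemidef_sub_groundEnergy hK).dotProduct_mulVec_nonneg v
  rw [sub_mulVec, dotProduct_sub, Algebra.algebraMap_eq_smul_one, smul_mulVec, one_mulVec,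
    dotProduct_smul] at h
  obtain ⟨hre, -⟩ := Complex.nonneg_iff.mp h
  simp only [Complex.sub_re, Complex.real_smul, Complex.mul_re, Complex.ofReal_re,
    Complex.ofReal_im, zero_mul, sub_zero] at hre
  linarith

/-- Equality case of the homogeneous variational principle: `Re ⟨v, K v⟩ ≤ E₀ ‖v‖²` forces
`v` into the ground space (Tasaki (2020) §2.1, Lemma 2.1). [cite: Tasaki2020, §2.1] -/
theorem mem_groundSpace_of_rayleigh_le [Nonempty m] {K : Matrix m m ℂ} (hK : K.IsHermitian)
    {v : m → ℂ} (hv : (star v ⬝ᵥ K *ᵥ v).re ≤ K.groundEnergy * (star v ⬝ᵥ v).re) :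
    v ∈ K.groundSpace := by
  have hP := posSemidef_sub_groundEnergy hK
  have h := hP.dotProduct_mulVec_nonneg v
  have hform : star v ⬝ᵥ (K - algebraMap ℝ (Matrix m m ℂ) K.groundEnergy) *ᵥ v =
      star v ⬝ᵥ K *ᵥ v - (K.groundEnergy : ℂ) * (star v ⬝ᵥ v) := by
    rw [sub_mulVec, dotProduct_sub, Algebra.algebraMap_eq_smul_one, smul_mulVec, one_mulVec,
      dotProduct_smul, Complex.real_smul]
  obtain ⟨hre, him⟩ := Complex.nonneg_iff.mp h
  have hvv : ((star v ⬝ᵥ v).im) = 0 := by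
    have hs : star (star v ⬝ᵥ v) = star v ⬝ᵥ v := (star_dotProduct v v).symm
    have := congrArg Complex.im hs
    rw [Complex.star_def, Complex.conj_im] at this
    linarith
  have hzero : star v ⬝ᵥ (K - algebraMap ℝ (Matrix m m ℂ) K.groundEnergy) *ᵥ v = 0 := by
    apply Complex.ext
    · rw [Complex.zero_re]
      refine le_antisymm ?_ hre
      rw [hform, Complex.sub_re, Complex.mul_re, Complex.ofReal_re, Complex.ofReal_im, zero_mul,
        sub_zero]
      linarith
    · rw [Complex.zero_im]; exact him.symm
  have hmul : (K - algebraMap ℝ (Matrix m m ℂ) K.groundEnergy) *ᵥ v = 0 :=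
    (hP.dotProduct_mulVec_zero_iff v).1 hzero
  rw [mem_groundSpace_iff]
  rw [sub_mulVec, Algebra.algebraMap_eq_smul_one, smul_mulVec, one_mulVec, sub_eq_zero] at hmul
  rw [hmul, Complex.coe_smul]

/-- **The Kennedy–Lieb–Shastry polar pair of a ground state are ground states**
([AizenmanEtAl2004] App. A, inequality (A) `⟨ψ|H'|ψ⟩ ≥ ½⟨ψ₁|H'|ψ₁⟩ + ½⟨ψ₂|H'|ψ₂⟩` with
`ψ̂₁ = (ψ̂ψ̂†)^{1/2}`, `ψ̂₂ = (ψ̂†ψ̂)^{1/2}`, «Since `|ψ⟩` is an absolute ground state we see that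
`|ψ₁⟩` and `|ψ₂⟩` are also absolute ground states»; Kennedy–Lieb–Shastry 1988 eqs. (23)–(25)):
for the reflection-symmetric real Kronecker Hamiltonian `K = A ⊗ 1 + 1 ⊗ A - Σᵢ Mᵢ ⊗ Mᵢ`
(`Aᵀ = A`, `Mᵢᵀ = Mᵢᴴ`, `K` Hermitian) and a ground-state vector `vec c`, there are `c_L, c_R ⪰ 0`
with `c_L² = c cᴴ`, `c_R² = cᴴ c` and `vec c_L`, `vec c_R` in the ground space.
[cite: AizenmanEtAl2004, Appendix A] [cite: KLS1988JSP, eqs. (23)–(25)] -/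
theorem exists_sqrt_pair_mem_groundSpace [Nonempty m] {ι : Type*} [Fintype ι] (A : Matrix m m ℂ)
    (M : ι → Matrix m m ℂ) (hA : Aᵀ = A) (hMt : ∀ i, (M i)ᵀ = (M i)ᴴ)
    (hK : (A ⊗ₖ (1 : Matrix m m ℂ) + (1 : Matrix m m ℂ) ⊗ₖ A - ∑ i, M i ⊗ₖ M i).IsHermitian)
    {c : Matrix m m ℂ}
    (hc : (fun p : m × m => c p.1 p.2) ∈
      (A ⊗ₖ (1 : Matrix m m ℂ) + (1 : Matrix m m ℂ) ⊗ₖ A - ∑ i, M i ⊗ₖ M i).groundSpace) :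
    ∃ cL cR : Matrix m m ℂ, cL.PosSemidef ∧ cR.PosSemidef ∧ cL * cL = c * cᴴ ∧ cR * cR = cᴴ * c ∧
      (fun p : m × m => cL p.1 p.2) ∈
        (A ⊗ₖ (1 : Matrix m m ℂ) + (1 : Matrix m m ℂ) ⊗ₖ A - ∑ i, M i ⊗ₖ M i).groundSpace ∧
      (fun p : m × m => cR p.1 p.2) ∈
        (A ⊗ₖ (1 : Matrix m m ℂ) + (1 : Matrix m m ℂ) ⊗ₖ A - ∑ i, M i ⊗ₖ M i).groundSpace := by
  set K := A ⊗ₖ (1 : Matrix m m ℂ) + (1 : Matrix m m ℂ) ⊗ₖ A - ∑ i, M i ⊗ₖ M i with hKdef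
  set E : ℝ := K.groundEnergy with hEdef
  obtain ⟨cL, cR, hLpsd, hRpsd, hLsq, hRsq, hineq⟩ := exists_kls_tracePair c
  -- norms
  have hnc : star (fun p : m × m => c p.1 p.2) ⬝ᵥ (fun p : m × m => c p.1 p.2) = trace (cᴴ * c) :=
    star_uncurry_dotProduct_uncurry c c
  have hnL : star (fun p : m × m => cL p.1 p.2) ⬝ᵥ (fun p : m × m => cL p.1 p.2) = trace (cᴴ * c) := by
    rw [star_uncurry_dotProduct_uncurry, hLpsd.1.eq, hLsq, trace_mul_comm]
  have hnR : star (fun p : m × m => cR p.1 p.2) ⬝ᵥ (fun p : m × m => cR p.1 p.2) = trace (cᴴ * c) := by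
    rw [star_uncurry_dotProduct_uncurry, hRpsd.1.eq, hRsq]
  -- the KLS inequality `R(c_L) + R(c_R) ≤ 2 R(c)`
  have hRP : (star (fun p : m × m => cL p.1 p.2) ⬝ᵥ (K *ᵥ fun p : m × m => cL p.1 p.2)).re +
      (star (fun p : m × m => cR p.1 p.2) ⬝ᵥ (K *ᵥ fun p : m × m => cR p.1 p.2)).re ≤
      2 * (star (fun p : m × m => c p.1 p.2) ⬝ᵥ (K *ᵥ fun p : m × m => c p.1 p.2)).re := by
    rw [hKdef, kronecker_hamiltonian_rayleigh, kronecker_hamiltonian_rayleigh,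
      kronecker_hamiltonian_rayleigh]
    simp only [hMt, hLpsd.1.eq, hRpsd.1.eq, hA, Complex.add_re, Complex.sub_re, Complex.re_sum]
    have t1 : trace (cL * A * cL) = trace (cᴴ * A * c) := by
      rw [trace_mul_cycle, hLsq, Matrix.mul_assoc, trace_mul_comm]
    have t2 : trace (cL * cL * A) = trace (cᴴ * A * c) := by
      rw [hLsq, Matrix.mul_assoc, trace_mul_comm, Matrix.mul_assoc]
    have t3 : trace (cR * A * cR) = trace (cᴴ * c * A) := by
      rw [trace_mul_cycle, hRsq]
    have t4 : trace (cR * cR * A) = trace (cᴴ * c * A) := by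
      rw [hRsq]
    rw [t1, t2, t3, t4]
    have hsum : 2 * (∑ i, (trace (cᴴ * M i * c * (M i)ᴴ)).re) ≤
        ∑ i, (trace (cL * M i * cL * (M i)ᴴ)).re + ∑ i, (trace (cR * M i * cR * (M i)ᴴ)).re := by
      rw [mul_sum, ← sum_add_distrib]
      exact sum_le_sum fun i _ => by linarith [hineq (M i) (M i)]
    linarith [hsum]
  -- `R(c) = E₀ ‖c‖²`
  have hRc : (star (fun p : m × m => c p.1 p.2) ⬝ᵥ (K *ᵥ fun p : m × m => c p.1 p.2)).re =
      E * (trace (cᴴ * c)).re := by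
    rw [(mem_groundSpace_iff K _).1 hc, dotProduct_smul, hnc, smul_eq_mul, Complex.mul_re,
      Complex.ofReal_re, Complex.ofReal_im, zero_mul, sub_zero]
  -- lower bounds and conclusion
  have hL := groundEnergy_mul_le_rayleigh hK (fun p : m × m => cL p.1 p.2)
  have hR := groundEnergy_mul_le_rayleigh hK (fun p : m × m => cR p.1 p.2)
  rw [hnL] at hL
  rw [hnR] at hR
  refine ⟨cL, cR, hLpsd, hRpsd, hLsq, hRsq, mem_groundSpace_of_rayleigh_le hK ?_,
    mem_groundSpace_of_rayleigh_le hK ?_⟩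
  · rw [hnL]; linarith
  · rw [hnR]; linarith

omit [DecidableEq m] in
/-- The norm `‖vec c‖² = Tr(cᴴc)` of a nonzero coefficient matrix is nonzero. [folklore] -/
private theorem trace_conjTranspose_mul_self_ne_zero {c : Matrix m m ℂ} (hc : c ≠ 0) :
    trace (cᴴ * c) ≠ 0 := by
  rw [← star_uncurry_dotProduct_uncurry]
  intro h
  apply hc
  have h0 := (dotProduct_star_self_eq_zero.1 h)
  ext a b
  exact congrFun h0 (a, b)

/-- **The polar-decomposition argument of [AizenmanEtAl2004] Appendix A** (abstract form). Let
`K = A ⊗ 1 + 1 ⊗ A - Σᵢ Mᵢ ⊗ Mᵢ` be a reflection-symmetric real Kronecker Hamiltonian (`Aᵀ = A`,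
`Mᵢᵀ = Mᵢᴴ`, `K` Hermitian), let `X` be real symmetric (`Xᵀ = X = Xᴴ`; printed: `S`, "represented
by a real symmetric matrix in the standard basis") and `S' = X ⊗ 1 - 1 ⊗ X` the two-sided
charge. Suppose the ground states of `K` annihilated by `S'` are unique up to scalars («the
ground state with this property is unique», by Perron–Frobenius in the application). Then every
ground state `ψ` of `K` with `S'ψ = mψ` has `m = 0`: writing `ψ = vec ĉ`, `S'ψ = mψ` reads
`Xĉ - ĉX = mĉ`, so `X` commutes with `ĉ†ĉ` and `ĉĉ†`, hence with their square roots
`ψ̂₂ = (ĉ†ĉ)^{1/2}`, `ψ̂₁ = (ĉĉ†)^{1/2}`; by `Matrix.exists_sqrt_pair_mem_groundSpace` both are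
ground states with `S' = 0`, so `ψ̂₁ = ψ̂₂`, i.e. `ĉ†ĉ = ĉĉ†`, and
`m‖ψ‖² = Tr(ĉ† X ĉ) - Tr(ĉ†ĉ X) = Tr(X ĉĉ†) - Tr(X ĉ†ĉ) = 0`.
[cite: AizenmanEtAl2004, Appendix A] -/
theorem kroneckerGroundState_charge_eigenvalue_eq_zero [Nonempty m] {ι : Type*} [Fintype ι]
    (A : Matrix m m ℂ) (M : ι → Matrix m m ℂ) (hA : Aᵀ = A) (hMt : ∀ i, (M i)ᵀ = (M i)ᴴ)
    (hK : (A ⊗ₖ (1 : Matrix m m ℂ) + (1 : Matrix m m ℂ) ⊗ₖ A - ∑ i, M i ⊗ₖ M i).IsHermitian)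
    (X : Matrix m m ℂ) (hXt : Xᵀ = X) (hXh : Xᴴ = X)
    (huniq : ∀ φ₁ φ₂ : m × m → ℂ,
      φ₁ ∈ (A ⊗ₖ (1 : Matrix m m ℂ) + (1 : Matrix m m ℂ) ⊗ₖ A - ∑ i, M i ⊗ₖ M i).groundSpace →
      φ₂ ∈ (A ⊗ₖ (1 : Matrix m m ℂ) + (1 : Matrix m m ℂ) ⊗ₖ A - ∑ i, M i ⊗ₖ M i).groundSpace →
      (X ⊗ₖ (1 : Matrix m m ℂ) + (1 : Matrix m m ℂ) ⊗ₖ (-X)) *ᵥ φ₁ = 0 →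
      (X ⊗ₖ (1 : Matrix m m ℂ) + (1 : Matrix m m ℂ) ⊗ₖ (-X)) *ᵥ φ₂ = 0 →
      φ₁ ≠ 0 → ∃ a : ℂ, φ₂ = a • φ₁)
    {ψ : m × m → ℂ}
    (hψ : ψ ∈ (A ⊗ₖ (1 : Matrix m m ℂ) + (1 : Matrix m m ℂ) ⊗ₖ A - ∑ i, M i ⊗ₖ M i).groundSpace)
    (hψ0 : ψ ≠ 0) {μ : ℂ}
    (hQ : (X ⊗ₖ (1 : Matrix m m ℂ) + (1 : Matrix m m ℂ) ⊗ₖ (-X)) *ᵥ ψ = μ • ψ) : μ = 0 := by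
  set K := A ⊗ₖ (1 : Matrix m m ℂ) + (1 : Matrix m m ℂ) ⊗ₖ A - ∑ i, M i ⊗ₖ M i with hKdef
  set Q := X ⊗ₖ (1 : Matrix m m ℂ) + (1 : Matrix m m ℂ) ⊗ₖ (-X) with hQdef
  -- `ψ = vec c`
  set c : Matrix m m ℂ := Matrix.of fun a b => ψ (a, b) with hc_def
  have hψc : (fun p : m × m => c p.1 p.2) = ψ := by
    funext p; rfl
  have hc0 : c ≠ 0 := by
    intro h
    apply hψ0
    rw [← hψc, h]
    rfl
  have ht : trace (cᴴ * c) ≠ 0 := trace_conjTranspose_mul_self_ne_zero hc0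
  -- the action of the charge on `vec e`: `Q vec e = vec (X e - e X)`
  have hQvec : ∀ e : Matrix m m ℂ, Q *ᵥ (fun p : m × m => e p.1 p.2) =
      fun p : m × m => (X * e - e * X) p.1 p.2 := by
    intro e
    rw [hQdef, kroneckerSum_mulVec_uncurry, transpose_neg, hXt, Matrix.mul_neg, ← sub_eq_add_neg]
  -- `X c - c X = μ c`
  have hXc : X * c - c * X = μ • c := by
    have h := hQvec c
    rw [hψc, hQ, ← hψc] at h
    ext a b
    have := congrFun h (a, b)
    simpa only [Pi.smul_apply, smul_apply] using this.symm
  -- `μ` is real: `μ ‖ψ‖² = ⟨ψ, Q ψ⟩` is real since `Q` is Hermitian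
  have hQh : Qᴴ = Q := by
    rw [hQdef, conjTranspose_add, conjTranspose_kronecker, conjTranspose_kronecker,
      conjTranspose_one, conjTranspose_neg, hXh]
  have hμreal : star μ = μ := by
    have h1 : star ψ ⬝ᵥ (Q *ᵥ ψ) = μ * (star ψ ⬝ᵥ ψ) := by
      rw [hQ, dotProduct_smul, smul_eq_mul]
    have h2 : star (star ψ ⬝ᵥ (Q *ᵥ ψ)) = star ψ ⬝ᵥ (Q *ᵥ ψ) := by
      conv_lhs => rw [star_dotProduct, star_star, star_mulVec, hQh, ← dotProduct_mulVec]
    have hn : star (star ψ ⬝ᵥ ψ) = star ψ ⬝ᵥ ψ := (star_dotProduct ψ ψ).symm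
    have hn0 : star ψ ⬝ᵥ ψ ≠ 0 := by rw [← hψc, star_uncurry_dotProduct_uncurry]; exact ht
    rw [h1, star_mul', hn] at h2
    exact mul_right_cancel₀ hn0 h2
  -- conjugate-transposed relation: `cᴴ X - X cᴴ = μ̄ cᴴ = μ cᴴ`
  have hXc' : cᴴ * X - X * cᴴ = μ • cᴴ := by
    have h := congrArg conjTranspose hXc
    rw [conjTranspose_sub, conjTranspose_mul, conjTranspose_mul, hXh, conjTranspose_smul,
      hμreal] at h
    exact h
  -- `X` commutes with `c cᴴ` and `cᴴ c`
  have e1 : X * c = c * X + μ • c := by rw [← hXc]; abel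
  have e2 : X * cᴴ = cᴴ * X - μ • cᴴ := by rw [← hXc']; abel
  have hcomm1 : Commute (c * cᴴ) X := by
    -- `X c cᴴ = (c X + μ c) cᴴ = c (X cᴴ) + μ c cᴴ = c (cᴴ X - μ cᴴ) + μ c cᴴ = c cᴴ X`
    show c * cᴴ * X = X * (c * cᴴ)
    symm
    calc X * (c * cᴴ) = X * c * cᴴ := (Matrix.mul_assoc _ _ _).symm
      _ = (c * X + μ • c) * cᴴ := by rw [e1]
      _ = c * (X * cᴴ) + μ • (c * cᴴ) := by rw [Matrix.add_mul, Matrix.smul_mul, Matrix.mul_assoc]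
      _ = c * (cᴴ * X - μ • cᴴ) + μ • (c * cᴴ) := by rw [e2]
      _ = c * cᴴ * X := by rw [Matrix.mul_sub, Matrix.mul_smul, ← Matrix.mul_assoc]; abel
  have hcomm2 : Commute (cᴴ * c) X := by
    show cᴴ * c * X = X * (cᴴ * c)
    symm
    calc X * (cᴴ * c) = X * cᴴ * c := (Matrix.mul_assoc _ _ _).symm
      _ = (cᴴ * X - μ • cᴴ) * c := by rw [e2]
      _ = cᴴ * (X * c) - μ • (cᴴ * c) := by rw [Matrix.sub_mul, Matrix.smul_mul, Matrix.mul_assoc]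
      _ = cᴴ * (c * X + μ • c) - μ • (cᴴ * c) := by rw [e1]
      _ = cᴴ * c * X := by rw [Matrix.mul_add, Matrix.mul_smul, ← Matrix.mul_assoc]; abel
  -- the polar pair
  obtain ⟨cL, cR, hLpsd, hRpsd, hLsq, hRsq, hLgs, hRgs⟩ :=
    exists_sqrt_pair_mem_groundSpace A M hA hMt hK (c := c) (by rw [hψc]; exact hψ)
  -- square roots commute with `X`
  have hLsqrt : CFC.sqrt (c * cᴴ) = cL :=
    CFC.sqrt_unique hLsq (Matrix.nonneg_iff_posSemidef.2 hLpsd)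
  have hRsqrt : CFC.sqrt (cᴴ * c) = cR :=
    CFC.sqrt_unique hRsq (Matrix.nonneg_iff_posSemidef.2 hRpsd)
  have hLcomm : Commute cL X := by
    rw [← hLsqrt]
    exact hcomm1.cfcₙ_nnreal _
  have hRcomm : Commute cR X := by
    rw [← hRsqrt]
    exact hcomm2.cfcₙ_nnreal _
  -- both are annihilated by the charge
  have hQL : Q *ᵥ (fun p : m × m => cL p.1 p.2) = 0 := by
    rw [hQvec, ← hLcomm.eq, sub_self]
    funext p
    simp
  have hQR : Q *ᵥ (fun p : m × m => cR p.1 p.2) = 0 := by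
    rw [hQvec, ← hRcomm.eq, sub_self]
    funext p
    simp
  -- `c_L ≠ 0`
  have hL0 : (fun p : m × m => cL p.1 p.2) ≠ 0 := by
    intro h
    apply ht
    have h1 : cL = 0 := by
      ext a b
      exact congrFun h (a, b)
    rw [← trace_mul_comm, ← hLsq, h1, Matrix.mul_zero, trace_zero]
  -- uniqueness in the sector `S' = 0`: `c_R = a c_L`, hence `cᴴ c = a² c cᴴ`, `a² = 1`
  obtain ⟨a, ha⟩ := huniq _ _ hLgs hRgs hQL hQR hL0
  have haM : cR = a • cL := by
    ext i j
    have := congrFun ha (i, j)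
    simpa only [Pi.smul_apply, smul_apply] using this
  have hsq : cᴴ * c = (a * a) • (c * cᴴ) := by
    rw [← hRsq, ← hLsq, haM, Matrix.smul_mul, Matrix.mul_smul, smul_smul]
  have haa : a * a = 1 := by
    have h := congrArg trace hsq
    rw [trace_smul, trace_mul_comm c cᴴ, smul_eq_mul] at h
    have h' : (a * a - 1) * trace (cᴴ * c) = 0 := by linear_combination -h
    rcases mul_eq_zero.1 h' with h1 | h1
    · exact sub_eq_zero.1 h1
    · exact absurd h1 ht
  have hnormal : cᴴ * c = c * cᴴ := by rw [hsq, haa, one_smul]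
  -- `μ Tr(cᴴ c) = Tr(cᴴ (X c - c X)) = Tr(X c cᴴ) - Tr(X cᴴ c) = 0`
  have key : μ * trace (cᴴ * c) = 0 := by
    have h := congrArg (fun Y => trace (cᴴ * Y)) hXc
    simp only [Matrix.mul_sub, Matrix.mul_smul, trace_sub, trace_smul, smul_eq_mul] at h
    rw [← h, ← Matrix.mul_assoc, trace_mul_cycle cᴴ X c, ← hnormal, ← Matrix.mul_assoc,
      trace_mul_comm (cᴴ * c) X, sub_self]
  rcases mul_eq_zero.1 key with h | h
  · exact h
  · exact absurd h ht

end Matrix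


/-! ## §2 Perron–Frobenius in the magnetisation sectors of the hard-core lattice gas -/

namespace Literature.MathematicalPhysics.QuantumLattice

section MatrixElements

variable {Λ : Type*} [Fintype Λ] [DecidableEq Λ] (n : ℕ) (G : SimpleGraph Λ) [DecidableRel G.Adj]

/-- The `3–3` bond `½(S³_x S³_y + S³_y S³_x)` is diagonal in the occupation basis: its matrix
element between distinct configurations vanishes (`S³` is diagonal). [cite: Tasaki2020, §2.2 eq. (2.2.5)] -/
theorem spinBond_two_apply_of_ne {x y : Λ} (hxy : x ≠ y) {σ τ : TensorIndex Λ (n + 1)}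
    (hστ : σ ≠ τ) : spinBond n 2 x y σ τ = 0 := by
  rw [spinBond_apply_of_ne n 2 hxy]
  split_ifs with hrest
  · have hdiag : ∀ k l : Fin (n + 1), k ≠ l → spinVec n 2 k l = 0 := fun k l hkl => by
      rw [spinVec_two, SpinOperators.spinZ, diagonal_apply_ne _ hkl]
    by_cases hx : σ x = τ x
    · have hy : σ y ≠ τ y := fun hy => hστ (funext fun z =>
        if hzx : z = x then hzx ▸ hx else if hzy : z = y then hzy ▸ hy else hrest z hzx hzy)
      rw [hdiag _ _ hy, mul_zero]
    · rw [hdiag _ _ hx, zero_mul]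
  · rfl

/-- **Off the diagonal, the XXZ Hamiltonian has the matrix elements of the Heisenberg
Hamiltonian** with the same exchange `J` (the anisotropy multiplies the diagonal `S³S³` bonds
only). Tasaki (2020) §2.4, remarks after eq. (2.4.1). [cite: Tasaki2020, §2.4] -/
theorem xxzHamiltonian_apply_of_ne (J Δ : ℝ) {σ τ : TensorIndex Λ (n + 1)} (hστ : σ ≠ τ) :
    xxzHamiltonian n G J Δ σ τ = heisenbergHamiltonian n G J σ τ := by
  simp only [xxzHamiltonian, heisenbergHamiltonian, Matrix.smul_apply, Matrix.sum_apply]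
  congr 1
  refine Finset.sum_congr rfl fun e he => ?_
  induction e using Sym2.ind with
  | h x y =>
    have hxy : x ≠ y :=
      G.ne_of_adj (by rwa [SimpleGraph.mem_edgeFinset, SimpleGraph.mem_edgeSet] at he)
    simp only [Sym2.lift_mk, spinDotSym_mk, spinDot, Matrix.sum_apply, Fin.sum_univ_three,
      Matrix.add_apply, Matrix.smul_apply, spinBond_two_apply_of_ne n hxy hστ, smul_zero, add_zero]

end MatrixElements

/-- Transfer of a chain along a relation to a second relation that agrees with it off the
diagonal (reflexive steps are dropped). [folklore] -/
private theorem reflTransGen_of_ne_imp {α : Type*} {r r' : α → α → Prop}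
    (h : ∀ a b, a ≠ b → r a b → r' a b) {s t : α} (hst : Relation.ReflTransGen r s t) :
    Relation.ReflTransGen r' s t := by
  induction hst with
  | refl => exact Relation.ReflTransGen.refl
  | @tail b c _ hbc ih =>
    by_cases hbc' : b = c
    · subst hbc'; exact ih
    · exact ih.tail (h _ _ hbc' hbc)

namespace HardCoreBoson

open Literature.Probability.LatticeModels Literature.Barriers.AtomisticToContinuum.BoseGas LiebMattis

variable {d : ℕ} {L : ℕ} [NeZero L]

/-- **Matrix elements of the hard-core lattice gas**: off the diagonal of the occupation basis,
`⟨σ|H|τ⟩ = -⟨σ|H_Heis(J=1)|τ⟩` — the hopping `-½(S⁺_x S⁻_y + h.c.)` has the matrix elements of the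
ferromagnetic exchange, and the staggered field is diagonal. (Hard-core bosons have no sign
problem: all off-diagonal elements are `≤ 0`.) [cite: AizenmanEtAl2004, Appendix A]
[cite: LSSY2005, Ch. 11 (11.2)] -/
theorem hardCoreLatticeGas_apply_of_ne (lam : ℝ) {σ τ : TensorIndex (TorusSite d L) 2}
    (hστ : σ ≠ τ) :
    hardCoreLatticeGas d L lam σ τ = -heisenbergHamiltonian 1 (torusGraph d L) 1 σ τ := by
  have hfield : (∑ x : TorusSite d L, ((1 / 2 : ℂ) • (1 : Op (TorusSite d L) 2) +
      ((-1 : ℂ) ^ (∑ i, (x i).val)) • siteSpin 1 x 2)) σ τ = 0 := by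
    rw [Matrix.sum_apply]
    refine Finset.sum_eq_zero fun x _ => ?_
    rw [Matrix.add_apply, Matrix.smul_apply, Matrix.smul_apply, Matrix.one_apply_ne hστ,
      siteSpin_two_eq_diagonal, diagonal_apply_ne _ hστ, smul_zero, smul_zero, add_zero]
  have hneg : heisenbergHamiltonian 1 (torusGraph d L) (-1) =
      -heisenbergHamiltonian 1 (torusGraph d L) 1 := by
    simp only [heisenbergHamiltonian, Complex.ofReal_neg, Complex.ofReal_one, neg_smul, one_smul]
  rw [hardCoreLatticeGas_eq, Matrix.add_apply, Matrix.smul_apply, hfield, smul_zero, add_zero]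
  show xxzHamiltonian 1 (torusGraph d L) (-1) 0 σ τ = _
  rw [xxzHamiltonian_apply_of_ne 1 (torusGraph d L) (-1) 0 hστ, hneg, Matrix.neg_apply]

/-- The matrix elements of the hard-core lattice gas are real. [cite: LSSY2005, Ch. 11 (11.2)] -/
theorem star_hardCoreLatticeGas_apply (lam : ℝ) (σ τ : TensorIndex (TorusSite d L) 2) :
    star (hardCoreLatticeGas d L lam σ τ) = hardCoreLatticeGas d L lam σ τ := by
  by_cases hστ : σ = τ
  · subst hστ
    exact (hardCoreLatticeGas_isHermitian d L lam).apply σ σ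
  · rw [hardCoreLatticeGas_apply_of_ne lam hστ, star_neg, star_heisenbergHamiltonian_apply]

/-- The hard-core lattice gas is a real symmetric matrix. [cite: LSSY2005, Ch. 11 (11.2)] -/
theorem hardCoreLatticeGas_apply_comm (lam : ℝ) (σ τ : TensorIndex (TorusSite d L) 2) :
    hardCoreLatticeGas d L lam σ τ = hardCoreLatticeGas d L lam τ σ := by
  rw [← (hardCoreLatticeGas_isHermitian d L lam).apply σ τ, star_hardCoreLatticeGas_apply]

/-- **No sign problem**: the off-diagonal matrix elements of the hard-core lattice gas are
nonpositive reals. [cite: AizenmanEtAl2004, Appendix A] -/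
theorem re_hardCoreLatticeGas_apply_nonpos (lam : ℝ) {σ τ : TensorIndex (TorusSite d L) 2}
    (hστ : σ ≠ τ) : (hardCoreLatticeGas d L lam σ τ).re ≤ 0 := by
  obtain ⟨t, ht0, ht⟩ := heisenbergHamiltonian_apply_eq_real 1 (torusGraph d L) 1 zero_le_one hστ
  rw [hardCoreLatticeGas_apply_of_ne lam hστ, ht, Complex.neg_re, Complex.ofReal_re]
  linarith

/-- `H` preserves the particle number: `⟨σ|H|τ⟩ = 0` unless `Σσ = Στ`.
[cite: AizenmanEtAl2004, Appendix A] -/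
theorem hardCoreLatticeGas_apply_eq_zero_of_weight_ne (lam : ℝ)
    {σ τ : TensorIndex (TorusSite d L) 2} (hw : (∑ x, (σ x : ℕ)) ≠ ∑ x, (τ x : ℕ)) :
    hardCoreLatticeGas d L lam σ τ = 0 :=
  apply_eq_zero_of_commute_totalSpin_two 1 (commute_hardCoreLatticeGas_totalSpin lam) hw

/-- **Perron–Frobenius in a particle-number sector of the hard-core lattice gas**
([AizenmanEtAl2004] App. A: «By a Perron-Frobenius argument the ground state of `H` restricted to
the subspace with fixed value of `Σ_x S³_x` is unique»). On the torus `(ℤ/Lℤ)^d` and for every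
staggered field `λ`, in every nonempty weight sector `W` (magnetisation `M = |Λ|/2 - W`, particle
number `N = |Λ| - W`): (1) the sector energy `E(M)` is attained at an eigenvector of `H` in the
sector; (2) it bounds the Rayleigh quotient on the sector from below; (3) eigenvectors of `H` at
`E(M)` in the sector are unique up to scalars; (4) a nonzero one has, after multiplication by a
nonzero constant, strictly positive coefficients on the whole sector. Proof: the compression of
`H` to the sector is a real symmetric matrix with nonpositive off-diagonal entries
(`re_hardCoreLatticeGas_apply_nonpos`) whose graph is connected (hops of one particle along the
edges of the connected torus graph, `LiebMattis.reflTransGen_of_weight_eq`); apply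
`perronFrobenius_groundState_unique` / `perronFrobenius_groundState_smul_pos`.
[cite: AizenmanEtAl2004, Appendix A] -/
theorem sector_perronFrobenius (lam : ℝ) (W : ℕ)
    (hW : ∃ σ : TensorIndex (TorusSite d L) 2, (∑ z, (σ z : ℕ)) = W) :
    (∃ ψ ∈ spinZSector (Λ := TorusSite d L) 1
        (((Fintype.card (TorusSite d L) * 1 : ℕ) : ℝ) / 2 - W), ψ ≠ 0 ∧
      hardCoreLatticeGas d L lam *ᵥ ψ =
        ((lowestEnergyInSector 1 (hardCoreLatticeGas d L lam)
          (((Fintype.card (TorusSite d L) * 1 : ℕ) : ℝ) / 2 - W) : ℝ) : ℂ) • ψ) ∧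
    (∀ φ ∈ spinZSector (Λ := TorusSite d L) 1
        (((Fintype.card (TorusSite d L) * 1 : ℕ) : ℝ) / 2 - W), star φ ⬝ᵥ φ = 1 →
      lowestEnergyInSector 1 (hardCoreLatticeGas d L lam)
        (((Fintype.card (TorusSite d L) * 1 : ℕ) : ℝ) / 2 - W) ≤
        (star φ ⬝ᵥ hardCoreLatticeGas d L lam *ᵥ φ).re) ∧
    (∀ ψ φ : TensorIndex (TorusSite d L) 2 → ℂ,
      ψ ∈ spinZSector (Λ := TorusSite d L) 1
        (((Fintype.card (TorusSite d L) * 1 : ℕ) : ℝ) / 2 - W) →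
      φ ∈ spinZSector (Λ := TorusSite d L) 1
        (((Fintype.card (TorusSite d L) * 1 : ℕ) : ℝ) / 2 - W) →
      hardCoreLatticeGas d L lam *ᵥ ψ =
        ((lowestEnergyInSector 1 (hardCoreLatticeGas d L lam)
          (((Fintype.card (TorusSite d L) * 1 : ℕ) : ℝ) / 2 - W) : ℝ) : ℂ) • ψ →
      hardCoreLatticeGas d L lam *ᵥ φ =
        ((lowestEnergyInSector 1 (hardCoreLatticeGas d L lam)
          (((Fintype.card (TorusSite d L) * 1 : ℕ) : ℝ) / 2 - W) : ℝ) : ℂ) • φ →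
      ψ ≠ 0 → ∃ c : ℂ, φ = c • ψ) ∧
    (∀ ψ : TensorIndex (TorusSite d L) 2 → ℂ,
      ψ ∈ spinZSector (Λ := TorusSite d L) 1
        (((Fintype.card (TorusSite d L) * 1 : ℕ) : ℝ) / 2 - W) →
      hardCoreLatticeGas d L lam *ᵥ ψ =
        ((lowestEnergyInSector 1 (hardCoreLatticeGas d L lam)
          (((Fintype.card (TorusSite d L) * 1 : ℕ) : ℝ) / 2 - W) : ℝ) : ℂ) • ψ →
      ψ ≠ 0 → ∃ c : ℂ, c ≠ 0 ∧ ∀ σ : TensorIndex (TorusSite d L) 2, (∑ z, (σ z : ℕ)) = W →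
        0 < (c * ψ σ).re ∧ (c * ψ σ).im = 0) := by
  set H := hardCoreLatticeGas d L lam with hHdef
  set M : ℝ := ((Fintype.card (TorusSite d L) * 1 : ℕ) : ℝ) / 2 - W with hMdef
  set K := spinZSector (Λ := TorusSite d L) 1 M with hKdef
  set E : ℝ := lowestEnergyInSector 1 H M with hEdef
  have hH : H.IsHermitian := hardCoreLatticeGas_isHermitian d L lam
  have hG : (torusGraph d L).Connected := torusGraph_connected_of_proj d L
  have hK : ∀ v, v ∈ K ↔ ∀ σ, ¬(∑ z, (σ z : ℕ)) = W → v σ = 0 :=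
    fun v => mem_spinZSector_weight_iff 1 W v
  have hinv : ∀ σ τ : TensorIndex (TorusSite d L) 2, ¬(∑ z, (σ z : ℕ)) = W →
      (∑ z, (τ z : ℕ)) = W → H σ τ = 0 := fun σ τ hσ hτ =>
    hardCoreLatticeGas_apply_eq_zero_of_weight_ne lam (by rw [hτ]; exact hσ)
  -- (1), (2): spectral theory in the invariant coordinate sector
  obtain ⟨h1, h2⟩ := sector_groundState H hH (fun σ => (∑ z, (σ z : ℕ)) = W) hW hinv K hK
  have hE : H.minEnergyOn K = E := rfl
  rw [hE] at h1 h2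
  -- the compression of `H` to the sector
  set ι := {σ : TensorIndex (TorusSite d L) 2 // (∑ z, (σ z : ℕ)) = W}
  set B : Matrix ι ι ℂ := Matrix.of fun s t => H s.1 t.1 with hBdef
  have hBapply : ∀ s t : ι, B s t = H s.1 t.1 := fun s t => rfl
  have hreal : ∀ s t : ι, star (B s t) = B s t := fun s t =>
    star_hardCoreLatticeGas_apply lam s.1 t.1
  have hsymm : ∀ s t : ι, B s t = B t s := fun s t =>
    hardCoreLatticeGas_apply_comm lam s.1 t.1
  have hoff : ∀ s t : ι, s ≠ t → (B s t).re ≤ 0 := fun s t hst => by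
    rw [hBapply]
    exact re_hardCoreLatticeGas_apply_nonpos lam fun h => hst (Subtype.ext h)
  have hconn : ∀ s t : ι, Relation.ReflTransGen (fun a b => B a b ≠ 0) s t := by
    intro s t
    have hchain := reflTransGen_subtype 1 (torusGraph d L) 1 hG zero_lt_one W
      (B := Matrix.of fun s t : ι => heisenbergHamiltonian 1 (torusGraph d L) 1 s.1 t.1)
      (fun s t hst => hst) s t
    refine reflTransGen_of_ne_imp (fun a b hab h => ?_) hchain
    have e : hardCoreLatticeGas d L lam a.1 b.1 =
        -heisenbergHamiltonian 1 (torusGraph d L) 1 a.1 b.1 :=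
      hardCoreLatticeGas_apply_of_ne lam fun h' => hab (Subtype.ext h')
    show hardCoreLatticeGas d L lam a.1 b.1 ≠ 0
    rw [e, neg_ne_zero]
    exact h
  -- extension by zero and restriction
  have hext_mem : ∀ v : ι → ℂ,
      (fun σ => if h : (∑ z, (σ z : ℕ)) = W then v ⟨σ, h⟩ else 0) ∈ K := by
    intro v
    rw [hK]
    intro σ hσ
    rw [dif_neg hσ]
  have hdot : ∀ (v : ι → ℂ) (w : TensorIndex (TorusSite d L) 2 → ℂ),
      star (fun σ => if h : (∑ z, (σ z : ℕ)) = W then v ⟨σ, h⟩ else 0) ⬝ᵥ w =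
        star v ⬝ᵥ fun s => w s.1 := by
    intro v w
    rw [dotProduct, dotProduct, sum_eq_sum_subtype_of_support (fun σ => (∑ z, (σ z : ℕ)) = W)]
    · refine Finset.sum_congr rfl fun s _ => ?_
      rw [Pi.star_apply, Pi.star_apply, dif_pos s.2]
    · intro σ hσ
      rw [Pi.star_apply, dif_neg hσ, star_zero, zero_mul]
  have hHext : ∀ (v : ι → ℂ) (s : ι),
      (H *ᵥ fun σ => if h : (∑ z, (σ z : ℕ)) = W then v ⟨σ, h⟩ else 0) s.1 = (B *ᵥ v) s := by
    intro v s
    rw [mulVec, dotProduct, mulVec, dotProduct,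
      sum_eq_sum_subtype_of_support (fun σ => (∑ z, (σ z : ℕ)) = W)]
    · refine Finset.sum_congr rfl fun t _ => ?_
      rw [dif_pos t.2, hBapply, Subtype.coe_eta]
    · intro τ hτ
      rw [dif_neg hτ, mul_zero]
  have hEB : ∀ v : ι → ℂ, E * (star v ⬝ᵥ v).re ≤ (star v ⬝ᵥ B *ᵥ v).re := by
    intro v
    set φ : TensorIndex (TorusSite d L) 2 → ℂ :=
      fun σ => if h : (∑ z, (σ z : ℕ)) = W then v ⟨σ, h⟩ else 0 with hφdef
    have hφφ : star φ ⬝ᵥ φ = star v ⬝ᵥ v := by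
      rw [hφdef, hdot]
      congr 1
      funext s
      rw [dif_pos s.2]
    have hφH : star φ ⬝ᵥ H *ᵥ φ = star v ⬝ᵥ B *ᵥ v := by
      rw [hφdef, hdot]
      congr 1
      funext s
      rw [hHext]
    have := mul_norm_le_of_unit_bound 1 H K h2 (hext_mem v)
    rw [hφφ, hφH] at this
    exact this
  -- restriction of sector eigenvectors
  have hres : ∀ ψ : TensorIndex (TorusSite d L) 2 → ℂ, ψ ∈ K → H *ᵥ ψ = (E : ℂ) • ψ →
      B *ᵥ (fun s : ι => ψ s.1) = (E : ℂ) • fun s : ι => ψ s.1 := by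
    intro ψ hψ hHψ
    funext s
    rw [Pi.smul_apply, smul_eq_mul, mulVec, dotProduct]
    have h := congrFun hHψ s.1
    rw [Pi.smul_apply, smul_eq_mul, mulVec, dotProduct,
      sum_eq_sum_subtype_of_support (fun σ => (∑ z, (σ z : ℕ)) = W)] at h
    · rw [← h]
      rfl
    · intro τ hτ
      rw [(hK ψ).1 hψ τ hτ, mul_zero]
  have hres0 : ∀ ψ : TensorIndex (TorusSite d L) 2 → ℂ, ψ ∈ K → ψ ≠ 0 →
      (fun s : ι => ψ s.1) ≠ 0 := by
    intro ψ hψ hψ0 h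
    apply hψ0
    funext σ
    by_cases hσ : (∑ z, (σ z : ℕ)) = W
    · exact congrFun h ⟨σ, hσ⟩
    · exact (hK ψ).1 hψ σ hσ
  refine ⟨h1, h2, ?_, ?_⟩
  · -- (3) uniqueness
    intro ψ φ hψ hφ hHψ hHφ hψ0
    obtain ⟨c, hc⟩ := perronFrobenius_groundState_unique hsymm hreal hoff hconn hEB
      (hres ψ hψ hHψ) (hres φ hφ hHφ) (hres0 ψ hψ hψ0)
    refine ⟨c, funext fun σ => ?_⟩
    by_cases hσ : (∑ z, (σ z : ℕ)) = W
    · have h := congrFun hc ⟨σ, hσ⟩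
      simpa only [Pi.smul_apply, smul_eq_mul] using h
    · rw [Pi.smul_apply, smul_eq_mul, (hK ψ).1 hψ σ hσ, (hK φ).1 hφ σ hσ, mul_zero]
  · -- (4) positivity
    intro ψ hψ hHψ hψ0
    obtain ⟨c, hc0, hc⟩ := perronFrobenius_groundState_smul_pos hsymm hreal hoff hconn hEB
      (hres ψ hψ hHψ) (hres0 ψ hψ hψ0)
    exact ⟨c, hc0, fun σ hσ => hc ⟨σ, hσ⟩⟩


/-! ## §3 Every ground state is at half filling, and the ground state is unique -/

section Transport

variable {ι p : Type*} [Fintype ι] [DecidableEq ι] [Fintype p] [DecidableEq p]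

omit [DecidableEq p] in
/-- Transport of the action along `W X Wᴴ = Y|_e`: `Y ((Wψ) ∘ e⁻¹) = (W X ψ) ∘ e⁻¹` (the passage
`H ↦ H'`, `S ↦ S'` of [AizenmanEtAl2004] App. A). [cite: AizenmanEtAl2004, Appendix A] -/
theorem mulVec_conj_transport {X W : Matrix ι ι ℂ} {Y : Matrix p p ℂ} (e : ι ≃ p)
    (hW' : Wᴴ * W = 1) (hconj : W * X * Wᴴ = Y.submatrix e e) (ψ : ι → ℂ) :
    Y *ᵥ ((W *ᵥ ψ) ∘ e.symm) = (W *ᵥ (X *ᵥ ψ)) ∘ e.symm := by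
  have hmat : W * X * Wᴴ * W = W * X := by rw [Matrix.mul_assoc, hW', Matrix.mul_one]
  have h1 : Y.submatrix e e *ᵥ (W *ᵥ ψ) = W *ᵥ (X *ᵥ ψ) := by
    rw [← hconj, mulVec_mulVec, hmat, ← mulVec_mulVec]
  rw [submatrix_mulVec_equiv] at h1
  funext q
  have := congrFun h1 (e.symm q)
  simpa using this

omit [DecidableEq p] in
/-- Transport back along `W X Wᴴ = Y|_e`: `X (Wᴴ (φ ∘ e)) = Wᴴ ((Y φ) ∘ e)`.
[cite: AizenmanEtAl2004, Appendix A] -/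
theorem mulVec_conj_transport_symm {X W : Matrix ι ι ℂ} {Y : Matrix p p ℂ} (e : ι ≃ p)
    (hW : W * Wᴴ = 1) (hW' : Wᴴ * W = 1) (hconj : W * X * Wᴴ = Y.submatrix e e) (φ : p → ℂ) :
    X *ᵥ (Wᴴ *ᵥ (φ ∘ e)) = Wᴴ *ᵥ ((Y *ᵥ φ) ∘ e) := by
  have hX : X = Wᴴ * Y.submatrix e e * W := by
    rw [← hconj]
    simp only [← Matrix.mul_assoc, hW', Matrix.one_mul]
    rw [Matrix.mul_assoc, hW', Matrix.mul_one]
  calc X *ᵥ (Wᴴ *ᵥ (φ ∘ e))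
      = Wᴴ *ᵥ (Y.submatrix e e *ᵥ ((W * Wᴴ) *ᵥ (φ ∘ e))) := by
        rw [hX]; simp only [← mulVec_mulVec]
    _ = Wᴴ *ᵥ (Y.submatrix e e *ᵥ (φ ∘ e)) := by rw [hW, one_mulVec]
    _ = Wᴴ *ᵥ ((Y *ᵥ φ) ∘ e) := by
        rw [submatrix_mulVec_equiv, Function.comp_assoc, Equiv.self_comp_symm, Function.comp_id]

omit [Fintype p] [DecidableEq p] in
/-- Round trip `φ ↦ Wᴴ(φ ∘ e) ↦ (W Wᴴ (φ ∘ e)) ∘ e⁻¹ = φ`. [folklore] -/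
private theorem conj_transport_roundtrip {W : Matrix ι ι ℂ} (e : ι ≃ p) (hW : W * Wᴴ = 1) (φ : p → ℂ) :
    (W *ᵥ (Wᴴ *ᵥ (φ ∘ e))) ∘ e.symm = φ := by
  rw [mulVec_mulVec, hW, one_mulVec, Function.comp_assoc, Equiv.self_comp_symm, Function.comp_id]

/-- Ground states go to ground states along `W H Wᴴ = K|_e` (`W` unitary).
[cite: AizenmanEtAl2004, Appendix A] -/
theorem mem_groundSpace_conj_transport [Nonempty ι] {H W : Matrix ι ι ℂ} {K : Matrix p p ℂ}
    (e : ι ≃ p) (hK : K.IsHermitian) (hW : W * Wᴴ = 1) (hW' : Wᴴ * W = 1)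
    (hconj : W * H * Wᴴ = K.submatrix e e) {ψ : ι → ℂ} (hψ : ψ ∈ H.groundSpace) :
    (W *ᵥ ψ) ∘ e.symm ∈ K.groundSpace := by
  rw [Matrix.mem_groundSpace_iff, mulVec_conj_transport e hW' hconj,
    (Matrix.mem_groundSpace_iff H ψ).1 hψ, mulVec_smul, groundEnergy_eq_of_conj_submatrix e hK hW hconj]
  rfl

/-- Ground states come back from ground states along `W H Wᴴ = K|_e` (`W` unitary).
[cite: AizenmanEtAl2004, Appendix A] -/
theorem mem_groundSpace_conj_transport_symm [Nonempty ι] {H W : Matrix ι ι ℂ} {K : Matrix p p ℂ}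
    (e : ι ≃ p) (hK : K.IsHermitian) (hW : W * Wᴴ = 1) (hW' : Wᴴ * W = 1)
    (hconj : W * H * Wᴴ = K.submatrix e e) {φ : p → ℂ} (hφ : φ ∈ K.groundSpace) :
    Wᴴ *ᵥ (φ ∘ e) ∈ H.groundSpace := by
  rw [Matrix.mem_groundSpace_iff, mulVec_conj_transport_symm e hW hW' hconj,
    (Matrix.mem_groundSpace_iff K φ).1 hφ, groundEnergy_eq_of_conj_submatrix e hK hW hconj,
    ← mulVec_smul]
  rfl

end Transport

/-- `|Λ| = L^d` for the torus `(ℤ/Lℤ)^d`. [folklore] -/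
private theorem card_torusSite : Fintype.card (TorusSite d L) = L ^ d := by
  simp [TorusSite, ZMod.card]

/-- The magnetisation-zero sector is the weight sector `W₀ = |Λ|/2` (even torus).
[cite: AizenmanEtAl2004, Appendix A] -/
theorem halfWeight_magnetisation_eq_zero (hd : 0 < d) (hL : Even L) :
    (((Fintype.card (TorusSite d L) * 1 : ℕ) : ℝ) / 2 -
        ((Fintype.card (TorusSite d L) / 2 : ℕ) : ℝ)) = 0 := by
  have hev : Even (Fintype.card (TorusSite d L)) := by
    rw [card_torusSite]
    exact Nat.even_pow.2 ⟨hL, hd.ne'⟩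
  obtain ⟨k, hk⟩ := hev
  rw [mul_one, hk, ← two_mul, Nat.mul_div_cancel_left _ two_pos]
  push_cast
  ring

/-- **Uniqueness in the half-filled sector** (Perron–Frobenius, [AizenmanEtAl2004] App. A: «the
ground state with this property is unique»): two ground states of the hard-core lattice gas with
`S³_tot = 0` are proportional. [cite: AizenmanEtAl2004, Appendix A] -/
theorem groundState_totalSpin_zero_unique (hd : 0 < d) (hL : Even L) (lam : ℝ)
    {ψ φ : TensorIndex (TorusSite d L) 2 → ℂ} (hψ : ψ ∈ (hardCoreLatticeGas d L lam).groundSpace)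
    (hφ : φ ∈ (hardCoreLatticeGas d L lam).groundSpace) (hSψ : totalSpin 1 2 *ᵥ ψ = 0)
    (hSφ : totalSpin 1 2 *ᵥ φ = 0) (hψ0 : ψ ≠ 0) : ∃ c : ℂ, φ = c • ψ := by
  set W₀ : ℕ := Fintype.card (TorusSite d L) / 2 with hW₀
  have hM0 := halfWeight_magnetisation_eq_zero (d := d) (L := L) hd hL
  have hsec : ∀ v : TensorIndex (TorusSite d L) 2 → ℂ, totalSpin 1 2 *ᵥ v = 0 →
      v ∈ spinZSector (Λ := TorusSite d L) 1
        (((Fintype.card (TorusSite d L) * 1 : ℕ) : ℝ) / 2 - (W₀ : ℕ)) := by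
    intro v hv
    rw [hM0, spinZSector, Module.End.mem_eigenspace_iff, Matrix.toLin'_apply, hv,
      Complex.ofReal_zero, zero_smul]
  have hψs := hsec ψ hSψ
  have hφs := hsec φ hSφ
  have hW : ∃ σ : TensorIndex (TorusSite d L) 2, (∑ z, (σ z : ℕ)) = W₀ := by
    by_contra hne
    push Not at hne
    exact hψ0 (funext fun σ => (mem_spinZSector_weight_iff 1 W₀ ψ).1 hψs σ (hne σ))
  obtain ⟨-, -, h3, -⟩ := sector_perronFrobenius (d := d) (L := L) lam W₀ hW
  rw [hM0, lowestEnergyInSector_zero_eq_groundEnergy hd hL lam] at h3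
  rw [hM0] at hψs hφs
  exact h3 ψ φ hψs hφs ((Matrix.mem_groundSpace_iff _ _).1 hψ)
    ((Matrix.mem_groundSpace_iff _ _).1 hφ) hψ0

/-- **Every absolute ground state of the hard-core lattice gas which is an eigenvector of
`S³_tot` has `S³_tot = 0`** ([AizenmanEtAl2004] Appendix A: «We claim that the absolute ground
state of `H` corresponds to the value `Σ_x S³_x = 0`» — there for THE ground state; here for
every ground-state eigenvector of `S³_tot`, which gives uniqueness below). Even torus
`(ℤ/Lℤ)^d`, `d ≥ 1`, any staggered field `λ`. Proof: after the sublattice flip `W` and the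
splitting along the planes `x₀ = ½`, `x₀ = ½ + L/2` (`HardCoreBoson.rotated_eq_submatrix`,
`stagSpin_eq_submatrix`), `H' = (A+λF)⊗1 + 1⊗(A+λF) - ΣMᵢ⊗Mᵢ` and `S' = F_ε⊗1 - 1⊗F_ε`; apply
the polar-decomposition argument `Matrix.kroneckerGroundState_charge_eigenvalue_eq_zero`, whose
uniqueness input is `groundState_totalSpin_zero_unique` transported along `W`.
[cite: AizenmanEtAl2004, Appendix A] -/
theorem groundState_totalSpin_eigenvalue_eq_zero (hd : 0 < d) (hL : Even L) (lam : ℝ)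
    {ψ : TensorIndex (TorusSite d L) 2 → ℂ} (hψ : ψ ∈ (hardCoreLatticeGas d L lam).groundSpace)
    (hψ0 : ψ ≠ 0) {μ : ℂ} (hS : totalSpin 1 2 *ᵥ ψ = μ • ψ) : μ = 0 := by
  have h2 : 2 ∣ L := even_iff_two_dvd.1 hL
  set j : Fin d := ⟨0, hd⟩ with hj
  set a : ZMod L := 0 with ha
  set e := torusSplit (q := 2) L j a hL with he
  set W := sublatticeFlip (d := d) L with hWdef
  set A := xyLeftHamiltonian L j a hL 1 0 + (lam : ℂ) • leftUniformField L j a with hA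
  set M := xyCrossOp L j a hL 1 0 with hM
  set Fs := leftStagSpin L j a with hFs
  have hW : W * Wᴴ = 1 := sublatticeFlip_mul_conjTranspose
  have hW' : Wᴴ * W = 1 := sublatticeFlip_conjTranspose_mul
  have hconj : W * hardCoreLatticeGas d L lam * Wᴴ =
      (A ⊗ₖ (1 : Op (torusLeftHalf L j a) 2) + (1 : Op (torusLeftHalf L j a) 2) ⊗ₖ A -
        ∑ i, M i ⊗ₖ M i).submatrix e e := by
    rw [hWdef, sublatticeFlip_conj_hardCoreLatticeGas h2 lam, rotated_eq_submatrix (hL := hL)]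
  have hconjS : W * totalSpin 1 2 * Wᴴ =
      (Fs ⊗ₖ (1 : Op (torusLeftHalf L j a) 2) + (1 : Op (torusLeftHalf L j a) 2) ⊗ₖ (-Fs)).submatrix
        e e := by
    rw [hWdef, sublatticeFlip_conj_totalSpin, stagSpin_eq_submatrix (hL := hL)]
  have hH := hardCoreLatticeGas_isHermitian d L lam
  have hK : (A ⊗ₖ (1 : Op (torusLeftHalf L j a) 2) + (1 : Op (torusLeftHalf L j a) 2) ⊗ₖ A -
      ∑ i, M i ⊗ₖ M i).IsHermitian := by
    have h := (Matrix.isHermitian_mul_mul_conjTranspose W hH).submatrix e.symm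
    rw [hconj, submatrix_submatrix, Equiv.self_comp_symm, submatrix_id_id] at h
    exact h
  have hAt : Aᵀ = A := by
    rw [hA, transpose_add, transpose_smul, xyLeftHamiltonian_transpose, leftUniformField_transpose]
  have hMt : ∀ i, (M i)ᵀ = (M i)ᴴ := fun i => xyCrossOp_transpose_eq L j a 1 hL 0 i
  have hFst : Fsᵀ = Fs := by rw [hFs]; exact leftStagSpin_transpose
  have hFsh : Fsᴴ = Fs := by rw [hFs]; exact leftStagSpin_isHermitian.eq
  haveI : Nonempty (torusLeftHalf L j a → Fin (1 + 1)) := ⟨fun _ => 0⟩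
  -- the ground state in the Kronecker picture
  have hφ := mem_groundSpace_conj_transport e hK hW hW' hconj hψ
  have hφ0 : (W *ᵥ ψ) ∘ e.symm ≠ 0 := by
    intro h
    apply hψ0
    have h1 : W *ᵥ ψ = 0 := by
      have h' : W *ᵥ ψ = ((W *ᵥ ψ) ∘ e.symm) ∘ e := by
        rw [Function.comp_assoc, Equiv.symm_comp_self, Function.comp_id]
      rw [h', h]
      rfl
    calc ψ = Wᴴ *ᵥ (W *ᵥ ψ) := by rw [mulVec_mulVec, hW', one_mulVec]
      _ = 0 := by rw [h1, mulVec_zero]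
  have hQφ : (Fs ⊗ₖ (1 : Op (torusLeftHalf L j a) 2) + (1 : Op (torusLeftHalf L j a) 2) ⊗ₖ (-Fs)) *ᵥ
      ((W *ᵥ ψ) ∘ e.symm) = μ • ((W *ᵥ ψ) ∘ e.symm) := by
    rw [mulVec_conj_transport e hW' hconjS, hS, mulVec_smul]
    rfl
  -- uniqueness in the sector `S' = 0`, transported from `groundState_totalSpin_zero_unique`
  have huniq : ∀ φ₁ φ₂ : (torusLeftHalf L j a → Fin 2) × (torusLeftHalf L j a → Fin 2) → ℂ,
      φ₁ ∈ (A ⊗ₖ (1 : Op (torusLeftHalf L j a) 2) + (1 : Op (torusLeftHalf L j a) 2) ⊗ₖ A -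
        ∑ i, M i ⊗ₖ M i).groundSpace →
      φ₂ ∈ (A ⊗ₖ (1 : Op (torusLeftHalf L j a) 2) + (1 : Op (torusLeftHalf L j a) 2) ⊗ₖ A -
        ∑ i, M i ⊗ₖ M i).groundSpace →
      (Fs ⊗ₖ (1 : Op (torusLeftHalf L j a) 2) + (1 : Op (torusLeftHalf L j a) 2) ⊗ₖ (-Fs)) *ᵥ
        φ₁ = 0 →
      (Fs ⊗ₖ (1 : Op (torusLeftHalf L j a) 2) + (1 : Op (torusLeftHalf L j a) 2) ⊗ₖ (-Fs)) *ᵥ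
        φ₂ = 0 →
      φ₁ ≠ 0 → ∃ c : ℂ, φ₂ = c • φ₁ := by
    intro φ₁ φ₂ h₁ h₂ hQ₁ hQ₂ h₁0
    have g₁ := mem_groundSpace_conj_transport_symm e hK hW hW' hconj h₁
    have g₂ := mem_groundSpace_conj_transport_symm e hK hW hW' hconj h₂
    have s₁ : totalSpin 1 2 *ᵥ (Wᴴ *ᵥ (φ₁ ∘ e)) = 0 := by
      rw [mulVec_conj_transport_symm e hW hW' hconjS, hQ₁]
      exact mulVec_zero _
    have s₂ : totalSpin 1 2 *ᵥ (Wᴴ *ᵥ (φ₂ ∘ e)) = 0 := by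
      rw [mulVec_conj_transport_symm e hW hW' hconjS, hQ₂]
      exact mulVec_zero _
    have n₁ : Wᴴ *ᵥ (φ₁ ∘ e) ≠ 0 := by
      intro h
      apply h₁0
      rw [← conj_transport_roundtrip e hW φ₁, h, mulVec_zero]
      rfl
    obtain ⟨c, hc⟩ := groundState_totalSpin_zero_unique hd hL lam g₁ g₂ s₁ s₂ n₁
    refine ⟨c, ?_⟩
    calc φ₂ = (W *ᵥ (Wᴴ *ᵥ (φ₂ ∘ e))) ∘ e.symm := (conj_transport_roundtrip e hW φ₂).symm
      _ = (W *ᵥ (c • (Wᴴ *ᵥ (φ₁ ∘ e)))) ∘ e.symm := by rw [hc]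
      _ = c • ((W *ᵥ (Wᴴ *ᵥ (φ₁ ∘ e))) ∘ e.symm) := by rw [mulVec_smul]; rfl
      _ = c • φ₁ := by rw [conj_transport_roundtrip e hW φ₁]
  exact Matrix.kroneckerGroundState_charge_eigenvalue_eq_zero A M hAt hMt hK Fs hFst hFsh huniq
    hφ hφ0 hQφ

/-- **`H` is block diagonal**: the weight components of an eigenvector of the hard-core gas are
eigenvectors (or zero) with the same eigenvalue (particle-number conservation).
[cite: AizenmanEtAl2004, Appendix A] -/
theorem hardCoreLatticeGas_mulVec_component (lam : ℝ) {Φ : TensorIndex (TorusSite d L) 2 → ℂ}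
    {μ : ℂ} (h : hardCoreLatticeGas d L lam *ᵥ Φ = μ • Φ) (W : ℕ) :
    hardCoreLatticeGas d L lam *ᵥ (fun σ => if (∑ z, (σ z : ℕ)) = W then Φ σ else 0) =
      μ • fun σ => if (∑ z, (σ z : ℕ)) = W then Φ σ else 0 := by
  funext σ
  rw [Pi.smul_apply, smul_eq_mul]
  by_cases hσ : (∑ z, (σ z : ℕ)) = W
  · rw [if_pos hσ]
    have h1 := congrFun h σ
    rw [Pi.smul_apply, smul_eq_mul] at h1
    rw [← h1, mulVec, mulVec, dotProduct, dotProduct]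
    refine Finset.sum_congr rfl fun τ _ => ?_
    by_cases hτ : (∑ z, (τ z : ℕ)) = W
    · rw [if_pos hτ]
    · rw [if_neg hτ, hardCoreLatticeGas_apply_eq_zero_of_weight_ne lam (by rw [hσ]; exact Ne.symm hτ),
        zero_mul, zero_mul]
  · rw [if_neg hσ, mul_zero]
    exact mulVec_supported_of_commute_totalSpin_two 1 (commute_hardCoreLatticeGas_totalSpin lam)
      (W := W) (fun τ hτ => if_neg hτ) σ hσ

/-- **Every ground state of the hard-core lattice gas is half filled**: `S³_tot ψ = 0` for every
ground-state vector `ψ`, i.e. the ground space lies in the sector `S³_tot = 0` (particle number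
`|Λ|/2`). Decompose `ψ` into weight components; each nonzero component is a ground state and an
eigenvector of `S³_tot`, hence has magnetisation `0` by
`groundState_totalSpin_eigenvalue_eq_zero`. [cite: AizenmanEtAl2004, Appendix A] -/
theorem groundState_totalSpin_eq_zero (hd : 0 < d) (hL : Even L) (lam : ℝ)
    {ψ : TensorIndex (TorusSite d L) 2 → ℂ} (hψ : ψ ∈ (hardCoreLatticeGas d L lam).groundSpace) :
    totalSpin 1 2 *ᵥ ψ = 0 := by
  have key : ∀ W : ℕ,
      totalSpin 1 2 *ᵥ (fun σ => if (∑ z, (σ z : ℕ)) = W then ψ σ else 0) = 0 := by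
    intro W
    have hmem := component_mem 1 ψ W
    have hSW : totalSpin (Λ := TorusSite d L) 1 2 *ᵥ
        (fun σ => if (∑ z, (σ z : ℕ)) = W then ψ σ else 0) =
        (((((Fintype.card (TorusSite d L) * 1 : ℕ) : ℝ) / 2 - W : ℝ)) : ℂ) •
          fun σ => if (∑ z, (σ z : ℕ)) = W then ψ σ else 0 := by
      rw [spinZSector, Module.End.mem_eigenspace_iff, Matrix.toLin'_apply] at hmem
      exact hmem
    have hgsW : (fun σ => if (∑ z, (σ z : ℕ)) = W then ψ σ else 0) ∈
        (hardCoreLatticeGas d L lam).groundSpace := by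
      rw [Matrix.mem_groundSpace_iff]
      exact hardCoreLatticeGas_mulVec_component lam ((Matrix.mem_groundSpace_iff _ _).1 hψ) W
    by_cases h0 : (fun σ => if (∑ z, (σ z : ℕ)) = W then ψ σ else 0) = 0
    · rw [h0, mulVec_zero]
    · rw [hSW, groundState_totalSpin_eigenvalue_eq_zero hd hL lam hgsW h0 hSW, zero_smul]
  calc totalSpin 1 2 *ᵥ ψ
      = totalSpin 1 2 *ᵥ ∑ W ∈ Finset.range (Fintype.card (TorusSite d L) * 1 + 1),
          (fun σ => if (∑ z, (σ z : ℕ)) = W then ψ σ else 0) := by rw [sum_components 1 ψ]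
    _ = ∑ W ∈ Finset.range (Fintype.card (TorusSite d L) * 1 + 1),
          totalSpin 1 2 *ᵥ (fun σ => if (∑ z, (σ z : ℕ)) = W then ψ σ else 0) := mulVec_sum _ _ _
    _ = 0 := Finset.sum_eq_zero fun W _ => key W

/-- The ground space of the hard-core lattice gas lies in the half-filled sector `S³_tot = 0`.
[cite: AizenmanEtAl2004, Appendix A] -/
theorem groundSpace_le_spinZSector_zero (hd : 0 < d) (hL : Even L) (lam : ℝ) :
    (hardCoreLatticeGas d L lam).groundSpace ≤ spinZSector (Λ := TorusSite d L) 1 0 := by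
  intro ψ hψ
  rw [spinZSector, Module.End.mem_eigenspace_iff, Matrix.toLin'_apply,
    groundState_totalSpin_eq_zero hd hL lam hψ, Complex.ofReal_zero, zero_smul]

/-- **The hard-core lattice Bose gas has a unique ground state** ([AizenmanEtAl2004] Appendix A:
«`H` has a unique ground state which has particle number `|Λ|/2`»; for `λ = 0` [Mattis1979] as
cited there): on the even torus `(ℤ/Lℤ)^d`, `d ≥ 1`, for every staggered field `λ`, the ground
space of `hardCoreLatticeGas d L λ` is one-dimensional. [cite: AizenmanEtAl2004, Appendix A] -/
theorem hasUniqueGroundState_hardCoreLatticeGas (hd : 0 < d) (hL : Even L) (lam : ℝ) :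
    (hardCoreLatticeGas d L lam).HasUniqueGroundState := by
  obtain ⟨ψ, hψ0, hψ, hS⟩ := exists_groundState_totalSpin_eq_zero hd hL lam
  rw [Matrix.HasUniqueGroundState, Matrix.groundStateDegeneracy]
  have hv0 : (⟨ψ, hψ⟩ : (hardCoreLatticeGas d L lam).groundSpace) ≠ 0 :=
    fun h => hψ0 (congrArg Subtype.val h)
  refine (finrank_eq_one_iff_of_nonzero' _ hv0).2 fun w => ?_
  obtain ⟨c, hc⟩ := groundState_totalSpin_zero_unique hd hL lam hψ w.2 hS
    (groundState_totalSpin_eq_zero hd hL lam w.2) hψ0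
  exact ⟨c, Subtype.ext (by simpa using hc.symm)⟩

/-- **Boson language: the unique ground state has exactly `|Λ|/2` particles** — every
ground-state vector of the hard-core lattice Bose gas (hopping `½`, any staggered potential
`λ(-1)^x n_x`, even torus) satisfies `N ψ = (|Λ|/2) ψ`. [cite: AizenmanEtAl2004, Appendix A] -/
theorem groundState_halfFilling (hd : 0 < d) (hL : Even L) (lam : ℝ)
    {ψ : TensorIndex (TorusSite d L) 2 → ℂ} (hψ : ψ ∈ (hardCoreLatticeGas d L lam).groundSpace) :
    (∑ x : TorusSite d L, num x) *ᵥ ψ = ((Fintype.card (TorusSite d L) : ℂ) / 2) • ψ := by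
  rw [sum_num_eq_totalSpin_add, add_mulVec, groundState_totalSpin_eq_zero hd hL lam hψ, zero_add,
    smul_mulVec, one_mulVec]

/-- **[AizenmanEtAl2004] Appendix A, complete statement**: the hard-core lattice Bose gas on the
even torus with any staggered potential has a unique ground state, and it has particle number
`|Λ|/2` (with the existence half `exists_groundState_halfFilling` of the companion file).
[cite: AizenmanEtAl2004, Appendix A] -/
theorem alssy_appendixA_groundState (hd : 0 < d) (hL : Even L) (lam : ℝ) :
    (hardCoreLatticeGas d L lam).HasUniqueGroundState ∧
      ∀ ψ ∈ (hardCoreLatticeGas d L lam).groundSpace,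
        (∑ x : TorusSite d L, num x) *ᵥ ψ = ((Fintype.card (TorusSite d L) : ℂ) / 2) • ψ :=
  ⟨hasUniqueGroundState_hardCoreLatticeGas hd hL lam, fun _ hψ => groundState_halfFilling hd hL lam hψ⟩

end HardCoreBoson

end Literature.MathematicalPhysics.QuantumLattice

end
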